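import Literature.Computability.Cryptography.CubicClassTableSemPow
import HarnessLib

/-!
# Semantics of the class-group table, III: the reduced representative `b_E` of `∏ 𝔤_t^{e_t}`

Topic `Computability/Cryptography`; theorem-only sequel of `CubicClassTableSemPow.lean` (crux
`LinnikCubicClassGroups.PureCubicClassGroupFBQP`, line `arakelov-giant-step-cycle`). In the context of that file:

* `WalkFns.bEc_eq_fold` — `bEc` as a pattern-matching-free fold;
* `WalkFns.slot_red_sem` — the first reduction of a generator slot coding a nonzero integral ideal `𝔤` with cylinder
  minimum `γ`: `redc (gT t) ~ γ⁻¹ 𝔤`, reduced, `|pos − 2^prec log σ₁ γ| ≤ 1`;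
* `WalkFns.bEc_sem` — **the reduced representative**: if the slots `gT v t` (`t < T`) code nonzero integral ideals `𝔤_t`
  with cylinder minima `γ_t`, then `bEc v ~ α⁻¹ ∏_{t<T} 𝔤_t^{e_t}` (`e_t` the digits of `v`), reduced, `σ₁ α > 0`,
  `|pos − 2^prec log σ₁ α| ≤ 3 Σ_t e_t` and `|log σ₁ α − Σ_t e_t log σ₁ γ_t| ≤ 2 log(3√|d_K|) Σ_t e_t`.
[Hallgren 2005, §4; Buchmann–Williams 1988, §3]

## References

* S. Hallgren, STOC 2005, §4. [Hallgren2005]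
* J. Buchmann, H. C. Williams, Math. Comp. 50 (1988), §3. [BuchmannWilliams1988]
-/

noncomputable section

namespace Literature.Computability.Cryptography

namespace CubicClassTable

open Literature.NumberTheory.CubicFields Literature.NumberTheory.CubicFields.PureCubicCodes
open scoped NumberField nonZeroDivisors
open NumberField

namespace WalkFns

section BE

variable {K : Type*} [Field K] [NumberField K] {θ : K} {σ₁ : K →+* ℝ} {σ₂ : K →+* ℂ} {F : WalkFns} {I : Inst}
variable (hdeg : Module.finrank ℚ K = 3) (hσ₂ : ∃ z : K, starRingEnd ℂ (σ₂ z) ≠ σ₂ z)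
  (hab : Squarefree (I.a * I.b)) (hab1 : I.a * I.b ≠ 1) (hθ : θ ^ 3 = ((I.a * I.b ^ 2 : ℕ) : K))
  (hred : RedSem F I.a I.b K θ σ₁ σ₂) (hprod : ProdSpec I.a I.b K θ F.latProd)
  {cap : ℕ} (hcap : (243 * I.a ^ 2 * I.b ^ 2) ^ 2 ≤ cap) (hprec : 4 * Nat.size (I.a * I.b) + 8 ≤ I.prec)
  (hord : Canon I.ord) (hordm : ∀ φ : K, Mem θ I.b I.ord φ ↔ IsIntegral ℤ φ)

/-- `bEc` as a pattern-matching-free fold. [folklore] -/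
theorem bEc_eq_fold (F : WalkFns) (I : Inst) (cap v : ℕ) :
    F.bEc I cap v = (((List.range I.T).foldl (fun acc t =>
      (F.powCc I cap (F.redc I cap (F.gT I v t)) (I.digit v t)).elim acc
        (fun x => some (acc.elim x (fun y => F.starCc I cap y x)))) none).getD (I.ord, 0)) := by
  unfold bEc
  congr 2
  funext acc t
  cases F.powCc I cap (F.redc I cap (F.gT I v t)) (I.digit v t) <;> cases acc <;> rfl

include hdeg hσ₂ hab hab1 hθ hred hcap in
/-- **The first reduction of a generator slot**: if `c` is the canonical code of the nonzero integral ideal `𝔤` whose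
cylinder minimum is `γ`, then `redc c ~ γ⁻¹ 𝔤`, reduced, `σ₁ γ > 1`, `|pos − 2^prec log σ₁ γ| ≤ 1`.
[cite: BuchmannWilliams1988, §3] -/
theorem slot_red_sem {c : Lat} {A : Ideal (𝓞 K)} (hA : A ≠ ⊥) (hc : Canon c)
    (hcA : ∀ φ : K, Mem θ I.b c φ ↔ φ ∈ (A : FractionalIdeal (𝓞 K)⁰ K)) {γ : K}
    (hγA : γ ∈ (A : FractionalIdeal (𝓞 K)⁰ K)) (hγpos : 0 < σ₁ γ) (hγ1 : ‖σ₂ γ‖ < 1)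
    (hγmin : ∀ φ : K, φ ∈ (A : FractionalIdeal (𝓞 K)⁰ K) → 0 < σ₁ φ → ‖σ₂ φ‖ < 1 → σ₁ γ ≤ σ₁ φ) :
    Canon (F.redc I cap c).1 ∧
      (∀ φ : K, Mem θ I.b (F.redc I cap c).1 φ ↔
        φ ∈ FractionalIdeal.spanSingleton (𝓞 K)⁰ γ⁻¹ * (A : FractionalIdeal (𝓞 K)⁰ K)) ∧
      (1 : K) ∈ posRelMinima σ₁ σ₂ (FractionalIdeal.spanSingleton (𝓞 K)⁰ γ⁻¹ * (A : FractionalIdeal (𝓞 K)⁰ K)) ∧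
      1 < σ₁ γ ∧ |((F.redc I cap c).2 : ℝ) - 2 ^ I.prec * Real.log (σ₁ γ)| ≤ 1 := by
  have hJ : (A : FractionalIdeal (𝓞 K)⁰ K) ≠ 0 := FractionalIdeal.coeIdeal_ne_zero.mpr hA
  have hcap1 : 243 * I.a ^ 2 * I.b ^ 2 ≤ cap := le_trans (Nat.le_self_pow two_ne_zero _) hcap
  rw [redc_eq_red hdeg hσ₂ hab hab1 hθ hred rfl hcap1 hJ hc hcA]
  obtain ⟨γ', hγ'J, hγ'pos, hγ'1, hγ'min, -, hlo, -, hcan, hmem, hone, hlog⟩ := red_sem hdeg hσ₂ hred hJ hc hcA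
  have hγγ : γ' = γ := σ₁.injective (le_antisymm (hγ'min γ hγA hγpos hγ1) (hγmin γ' hγ'J hγ'pos hγ'1))
  subst hγγ
  rw [FractionalIdeal.coeIdeal_absNorm, Rat.cast_natCast] at hlo
  have hN1 : (1 : ℝ) ≤ (Ideal.absNorm A : ℝ) := by
    exact_mod_cast Nat.one_le_iff_ne_zero.mpr (by rw [Ne, Ideal.absNorm_eq_zero_iff]; exact hA)
  have h1 : 1 < σ₁ γ' := lt_of_le_of_lt hN1 hlo
  have hprec' : (1 : ℝ) / 2 ^ I.prec ≤ σ₁ γ' := by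
    have : (1 : ℝ) / 2 ^ I.prec ≤ 1 := by
      rw [div_le_one (by positivity)]; exact one_le_pow₀ (by norm_num)
    linarith
  exact ⟨hcan, hmem, hone, h1, hlog hprec'⟩

include hdeg hσ₂ hab hab1 hθ hred hprod hcap hprec in
/-- **The reduced representative `b_E`** (windowed form): the fold over the first `n` slots. [cite: Hallgren2005, §4] -/
theorem bEc_fold_sem (v : ℕ) (𝔤 : ℕ → Ideal (𝓞 K)) (γ : ℕ → K)
    (hslot : ∀ t < I.T, 𝔤 t ≠ ⊥ ∧ Canon (F.gT I v t) ∧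
      (∀ φ : K, Mem θ I.b (F.gT I v t) φ ↔ φ ∈ (𝔤 t : FractionalIdeal (𝓞 K)⁰ K)) ∧
      γ t ∈ (𝔤 t : FractionalIdeal (𝓞 K)⁰ K) ∧ 0 < σ₁ (γ t) ∧ ‖σ₂ (γ t)‖ < 1 ∧
      (∀ φ : K, φ ∈ (𝔤 t : FractionalIdeal (𝓞 K)⁰ K) → 0 < σ₁ φ → ‖σ₂ φ‖ < 1 → σ₁ (γ t) ≤ σ₁ φ)) :
    ∀ n ≤ I.T,
      ((∀ t < n, I.digit v t = 0) ∧ (List.range n).foldl (fun acc t =>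
          (F.powCc I cap (F.redc I cap (F.gT I v t)) (I.digit v t)).elim acc
            (fun x => some (acc.elim x (fun y => F.starCc I cap y x)))) none = none) ∨
      (∃ y : PLat, (List.range n).foldl (fun acc t =>
          (F.powCc I cap (F.redc I cap (F.gT I v t)) (I.digit v t)).elim acc
            (fun x => some (acc.elim x (fun y => F.starCc I cap y x)))) none = some y ∧
        ∃ α : K, 0 < σ₁ α ∧ Canon y.1 ∧
          (∀ φ : K, Mem θ I.b y.1 φ ↔ φ ∈ FractionalIdeal.spanSingleton (𝓞 K)⁰ α⁻¹ *
            ∏ t ∈ Finset.range n, (𝔤 t : FractionalIdeal (𝓞 K)⁰ K) ^ I.digit v t) ∧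
          (1 : K) ∈ posRelMinima σ₁ σ₂ (FractionalIdeal.spanSingleton (𝓞 K)⁰ α⁻¹ *
            ∏ t ∈ Finset.range n, (𝔤 t : FractionalIdeal (𝓞 K)⁰ K) ^ I.digit v t) ∧
          |(y.2 : ℝ) - 2 ^ I.prec * Real.log (σ₁ α)| ≤ 3 * ∑ t ∈ Finset.range n, (I.digit v t : ℝ) ∧
          |Real.log (σ₁ α) - ∑ t ∈ Finset.range n, (I.digit v t : ℝ) * Real.log (σ₁ (γ t))| ≤
            2 * Real.log (3 * Real.sqrt |(discr K : ℝ)|) * ∑ t ∈ Finset.range n, (I.digit v t : ℝ)) := by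
  obtain ⟨hL0, -⟩ := logB_bounds (K := K)
  intro n
  induction n with
  | zero => intro _; exact Or.inl ⟨fun t ht => absurd ht (Nat.not_lt_zero t), rfl⟩
  | succ n ih =>
    intro hn
    have hn' : n < I.T := Nat.lt_of_succ_le hn
    rw [List.range_succ, List.foldl_append, List.foldl_cons, List.foldl_nil]
    obtain ⟨h𝔤, hcg, hmg, hγA, hγpos, hγ1, hγmin⟩ := hslot n hn'
    obtain ⟨hcan_g, hmem_g, hone_g, h1g, hlog_g⟩ :=
      slot_red_sem hdeg hσ₂ hab hab1 hθ hred hcap h𝔤 hcg hmg hγA hγpos hγ1 hγmin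
    have hdig : I.digit v n < 2 ^ I.ℓe := Nat.mod_lt _ (by unfold Inst.M; positivity)
    rcases ih hn'.le with ⟨hzero, hacc⟩ | ⟨y, hacc, α, hα, hy, hyM, hone, herr, hdr⟩
    · -- nothing accumulated so far
      rw [hacc]
      rcases Nat.eq_zero_or_pos (I.digit v n) with hd0 | hdpos
      · left
        refine ⟨fun t ht => ?_, ?_⟩
        · rcases Nat.lt_succ_iff_lt_or_eq.mp ht with h | h
          · exact hzero t h
          · rw [h]; exact hd0
        · rw [hd0, powCc_zero hdeg hσ₂ hab hab1 hθ hred hprod hcap hprec]; rfl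
      · right
        obtain ⟨x, hx, β, hβ, hcx, hmx, honex, herrx, hdrx⟩ :=
          powCc_sem hdeg hσ₂ hab hab1 hθ hred hprod hcap hprec hγpos hcan_g hmem_g hone_g hlog_g hdpos hdig
        have hprod0 : ∏ t ∈ Finset.range (n + 1), (𝔤 t : FractionalIdeal (𝓞 K)⁰ K) ^ I.digit v t =
            (𝔤 n : FractionalIdeal (𝓞 K)⁰ K) ^ I.digit v n := by
          rw [Finset.prod_range_succ, Finset.prod_eq_one (fun t ht => ?_), one_mul]
          rw [hzero t (Finset.mem_range.mp ht), pow_zero]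
        have hsum0 : ∑ t ∈ Finset.range (n + 1), (I.digit v t : ℝ) = I.digit v n := by
          rw [Finset.sum_range_succ, Finset.sum_eq_zero (fun t ht => ?_), zero_add]
          rw [hzero t (Finset.mem_range.mp ht), Nat.cast_zero]
        have hsum1 : ∑ t ∈ Finset.range (n + 1), (I.digit v t : ℝ) * Real.log (σ₁ (γ t)) =
            I.digit v n * Real.log (σ₁ (γ n)) := by
          rw [Finset.sum_range_succ, Finset.sum_eq_zero (fun t ht => ?_), zero_add]
          rw [hzero t (Finset.mem_range.mp ht), Nat.cast_zero, zero_mul]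
        refine ⟨x, by rw [hx]; rfl, β, hβ, hcx, by rw [hprod0]; exact hmx, by rw [hprod0]; exact honex, ?_, ?_⟩
        · rw [hsum0]; linarith
        · rw [hsum1, hsum0]
          have h1 : (1 : ℝ) ≤ I.digit v n := by exact_mod_cast hdpos
          nlinarith
    · -- something accumulated: `acc = some y`
      rw [hacc]
      right
      rcases Nat.eq_zero_or_pos (I.digit v n) with hd0 | hdpos
      · rw [hd0, powCc_zero hdeg hσ₂ hab hab1 hθ hred hprod hcap hprec]
        refine ⟨y, rfl, α, hα, hy, ?_, ?_, ?_, ?_⟩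
        · rw [Finset.prod_range_succ, hd0, pow_zero, mul_one]; exact hyM
        · rw [Finset.prod_range_succ, hd0, pow_zero, mul_one]; exact hone
        · rw [Finset.sum_range_succ, hd0, Nat.cast_zero, add_zero]; exact herr
        · rw [Finset.sum_range_succ, Finset.sum_range_succ, hd0, Nat.cast_zero, zero_mul, add_zero, add_zero]; exact hdr
      · obtain ⟨x, hx, β, hβ, hcx, hmx, honex, herrx, hdrx⟩ :=
          powCc_sem hdeg hσ₂ hab hab1 hθ hred hprod hcap hprec hγpos hcan_g hmem_g hone_g hlog_g hdpos hdig
        rw [hx]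
        obtain ⟨γ', hγ', hcan, hmem, hone', hpos, hlg⟩ :=
          starCc_mul_sem hdeg hσ₂ hab hab1 hθ hred hprod hcap hprec hy hyM hone hcx hmx honex
        have hprodS : ∏ t ∈ Finset.range (n + 1), (𝔤 t : FractionalIdeal (𝓞 K)⁰ K) ^ I.digit v t =
            (∏ t ∈ Finset.range n, (𝔤 t : FractionalIdeal (𝓞 K)⁰ K) ^ I.digit v t) *
              (𝔤 n : FractionalIdeal (𝓞 K)⁰ K) ^ I.digit v n := Finset.prod_range_succ _ _
        refine ⟨F.starCc I cap y x, rfl, α * β * γ', by rw [map_mul, map_mul]; positivity, hcan,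
          by rw [hprodS]; exact hmem, by rw [hprodS]; exact hone', ?_, ?_⟩
        · have hl : Real.log (σ₁ (α * β * γ')) = Real.log (σ₁ α) + Real.log (σ₁ β) + Real.log (σ₁ γ') := by
            rw [map_mul, map_mul, Real.log_mul (by positivity) hγ'.ne', Real.log_mul hα.ne' hβ.ne']
          rw [hl, Finset.sum_range_succ]
          have e : ((F.starCc I cap y x).2 : ℝ) = (((F.starCc I cap y x).2 - y.2 - x.2 : ℤ) : ℝ) + y.2 + x.2 := by
            push_cast; ring
          rw [e, abs_le]
          rw [abs_le] at herr herrx hpos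
          push_cast
          have h1 : (1 : ℝ) ≤ I.digit v n := by exact_mod_cast hdpos
          constructor <;> linarith [herr.1, herr.2, herrx.1, herrx.2, hpos.1, hpos.2]
        · have hl : Real.log (σ₁ (α * β * γ')) = Real.log (σ₁ α) + Real.log (σ₁ β) + Real.log (σ₁ γ') := by
            rw [map_mul, map_mul, Real.log_mul (by positivity) hγ'.ne', Real.log_mul hα.ne' hβ.ne']
          rw [hl, Finset.sum_range_succ, Finset.sum_range_succ]
          rw [abs_le]
          rw [abs_le] at hdr hdrx hlg
          have h1 : (1 : ℝ) ≤ I.digit v n := by exact_mod_cast hdpos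
          constructor <;> nlinarith [hdr.1, hdr.2, hdrx.1, hdrx.2, hlg.1, hlg.2, hL0, h1]

include hdeg hσ₂ hab hab1 hθ hred hprod hcap hprec hord hordm in
/-- **The reduced representative `b_E` of `∏_{t<T} 𝔤_t^{e_t}`**: reduced, position within `3 Σ e_t` of
`2^prec log σ₁ α`, and the accumulated distance `log σ₁ α` within `2 log(3√|d_K|) Σ e_t` of the AFFINE form
`Σ_t e_t log σ₁ γ_t` (`γ_t` the cylinder minimum of `𝔤_t`). [cite: Hallgren2005, §4] -/
theorem bEc_sem (v : ℕ) (𝔤 : ℕ → Ideal (𝓞 K)) (γ : ℕ → K)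
    (hslot : ∀ t < I.T, 𝔤 t ≠ ⊥ ∧ Canon (F.gT I v t) ∧
      (∀ φ : K, Mem θ I.b (F.gT I v t) φ ↔ φ ∈ (𝔤 t : FractionalIdeal (𝓞 K)⁰ K)) ∧
      γ t ∈ (𝔤 t : FractionalIdeal (𝓞 K)⁰ K) ∧ 0 < σ₁ (γ t) ∧ ‖σ₂ (γ t)‖ < 1 ∧
      (∀ φ : K, φ ∈ (𝔤 t : FractionalIdeal (𝓞 K)⁰ K) → 0 < σ₁ φ → ‖σ₂ φ‖ < 1 → σ₁ (γ t) ≤ σ₁ φ)) :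
    ∃ α : K, 0 < σ₁ α ∧ Canon (F.bEc I cap v).1 ∧
      (∀ φ : K, Mem θ I.b (F.bEc I cap v).1 φ ↔ φ ∈ FractionalIdeal.spanSingleton (𝓞 K)⁰ α⁻¹ *
        ∏ t ∈ Finset.range I.T, (𝔤 t : FractionalIdeal (𝓞 K)⁰ K) ^ I.digit v t) ∧
      (1 : K) ∈ posRelMinima σ₁ σ₂ (FractionalIdeal.spanSingleton (𝓞 K)⁰ α⁻¹ *
        ∏ t ∈ Finset.range I.T, (𝔤 t : FractionalIdeal (𝓞 K)⁰ K) ^ I.digit v t) ∧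
      |((F.bEc I cap v).2 : ℝ) - 2 ^ I.prec * Real.log (σ₁ α)| ≤ 3 * ∑ t ∈ Finset.range I.T, (I.digit v t : ℝ) ∧
      |Real.log (σ₁ α) - ∑ t ∈ Finset.range I.T, (I.digit v t : ℝ) * Real.log (σ₁ (γ t))| ≤
        2 * Real.log (3 * Real.sqrt |(discr K : ℝ)|) * ∑ t ∈ Finset.range I.T, (I.digit v t : ℝ) := by
  rw [bEc_eq_fold]
  rcases bEc_fold_sem hdeg hσ₂ hab hab1 hθ hred hprod hcap hprec v 𝔤 γ hslot I.T le_rfl with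
    ⟨hzero, hacc⟩ | ⟨y, hacc, α, hα, hy, hyM, hone, herr, hdr⟩
  · rw [hacc]
    have hprod1 : ∏ t ∈ Finset.range I.T, (𝔤 t : FractionalIdeal (𝓞 K)⁰ K) ^ I.digit v t = 1 :=
      Finset.prod_eq_one fun t ht => by rw [hzero t (Finset.mem_range.mp ht), pow_zero]
    have hsum0 : ∑ t ∈ Finset.range I.T, (I.digit v t : ℝ) = 0 :=
      Finset.sum_eq_zero fun t ht => by rw [hzero t (Finset.mem_range.mp ht), Nat.cast_zero]
    have hsum1 : ∑ t ∈ Finset.range I.T, (I.digit v t : ℝ) * Real.log (σ₁ (γ t)) = 0 :=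
      Finset.sum_eq_zero fun t ht => by rw [hzero t (Finset.mem_range.mp ht), Nat.cast_zero, zero_mul]
    have h11 : FractionalIdeal.spanSingleton (𝓞 K)⁰ (1 : K)⁻¹ * (1 : FractionalIdeal (𝓞 K)⁰ K) = 1 := by
      rw [inv_one, FractionalIdeal.spanSingleton_one, one_mul]
    refine ⟨1, by rw [map_one]; exact one_pos, hord, fun φ => ?_, ?_, ?_, ?_⟩
    · rw [hprod1, h11, mem_one_iff_isIntegral]; exact hordm φ
    · rw [hprod1, h11]; exact one_mem_posRelMinima_one hdeg hσ₂
    · rw [hsum0, map_one, Real.log_one]; simp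
    · rw [hsum1, hsum0, map_one, Real.log_one]; simp
  · rw [hacc]
    exact ⟨α, hα, hy, hyM, hone, herr, hdr⟩

end BE

end WalkFns


section Summary

/-- **Summary (registered helper of the class-group stage)**: the reduced representative `b_E` of `∏ 𝔤_t^{e_t}` and the affine main term of its distance. [cite: Hallgren2005, §4] -/
theorem cubicClassTable_bEc_sem : ∀ (K : Type) [Field K] [NumberField K], Module.finrank ℚ K = 3 → ∀ (θ : K) (σ₁ : K →+* ℝ) (σ₂ : K →+* ℂ), (∃ z : K, starRingEnd ℂ (σ₂ z) ≠ σ₂ z) → ∀ (F : CubicClassTable.WalkFns) (I : CubicClassTable.Inst), Squarefree (I.a * I.b) → I.a * I.b ≠ 1 → θ ^ 3 = ((I.a * I.b ^ 2 : ℕ) : K) → CubicClassTable.RedSem F I.a I.b K θ σ₁ σ₂ → CubicClassTable.ProdSpec I.a I.b K θ F.latProd → ∀ (cap : ℕ), (243 * I.a ^ 2 * I.b ^ 2) ^ 2 ≤ cap → 4 * Nat.size (I.a * I.b) + 8 ≤ I.prec → PureCubicCodes.Canon I.ord → (∀ φ : K, PureCubicCodes.Mem θ I.b I.ord φ ↔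 IsIntegral ℤ φ) → ∀ (v : ℕ) (𝔤 : ℕ → Ideal (𝓞 K)) (γ : ℕ → K), (∀ t < I.T, 𝔤 t ≠ ⊥ ∧ PureCubicCodes.Canon (F.gT I v t) ∧ (∀ φ : K, PureCubicCodes.Mem θ I.b (F.gT I v t) φ ↔ φ ∈ (𝔤 t : FractionalIdeal (𝓞 K)⁰ K)) ∧ γ t ∈ (𝔤 t : FractionalIdeal (𝓞 K)⁰ K) ∧ 0 < σ₁ (γ t) ∧ ‖σ₂ (γ t)‖ < 1 ∧ (∀ φ : K, φ ∈ (𝔤 t : FractionalIdeal (𝓞 K)⁰ K) → 0 < σ₁ φ → ‖σ₂ φ‖ < 1 → σ₁ (γ t) ≤ σ₁ φ)) → ∃ α : K, 0 < σ₁ α ∧ PureCubicCodes.Canon (F.bEc I cap v).1 ∧ (∀ φ : K, PureCubicCodes.Mem θ I.b (F.bEc I cap v).1 φ ↔ φ ∈ FractionalIdeal.spanSingleton (𝓞 K)⁰ α⁻¹ * ∏ t ∈ Finset.range I.T, (𝔤 t : FractionalIdeal (𝓞 K)⁰ K) ^ I.digit v t) ∧ (1 : K) ∈ posRelMinima σ₁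 σ₂ (FractionalIdeal.spanSingleton (𝓞 K)⁰ α⁻¹ * ∏ t ∈ Finset.range I.T, (𝔤 t : FractionalIdeal (𝓞 K)⁰ K) ^ I.digit v t) ∧ |((F.bEc I cap v).2 : ℝ) - 2 ^ I.prec * Real.log (σ₁ α)| ≤ 3 * ∑ t ∈ Finset.range I.T, (I.digit v t : ℝ) ∧ |Real.log (σ₁ α) - ∑ t ∈ Finset.range I.T, (I.digit v t : ℝ) * Real.log (σ₁ (γ t))| ≤ 2 * Real.log (3 * Real.sqrt |(NumberField.discr K : ℝ)|) * ∑ t ∈ Finset.range I.T, (I.digit v t : ℝ) :=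
  fun _ _ _ hdeg _ _ _ hσ₂ _ _ hab hab1 hθ hred hprod _ hcap hprec hord hordm v 𝔤 γ hslot =>
    WalkFns.bEc_sem hdeg hσ₂ hab hab1 hθ hred hprod hcap hprec hord hordm v 𝔤 γ hslot

end Summary

end CubicClassTable

end Literature.Computability.Cryptography
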